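import Summits.BirchSwinnertonDyer.BirchSwinnertonDyer.Theses.TangentCone
import Literature.NumberTheory.EllipticCurves.PAdicLFunction
import Literature.NumberTheory.EllipticCurves.PAdicLFunctionNeZeroHoldsProofs
import Literature.NumberTheory.EllipticCurves.HidaFamilyMembers
import HarnessLib

/-!
# BirchSwinnertonDyer / TangentCone — crux `EdgeCap` (stmt-BirchSwinnertonDyer-17609), line
# `ratio_measure_strassmann` (skeleton v7), stub L `stub_padicLFunctionNeZero`:
# reduction to the Modularity Theorem

Stub L of the registered skeleton v7 of line `ratio_measure_strassmann`
(`Cruxes/EdgeCap/Lines/ratio_measure_strassmann.lean`, `EdgeCap_of : M → G → L → A2 → EdgeCap`)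
asks, for a globally minimal `W` (elliptic, conductor `N = W.conductorNorm ℤ ≠ 0`) and a prime
`p ≥ 5` of good ordinary reduction (`p ∤ a_p(E)`), for a newform `f ∈ S₂(Γ₀(N))` attached to `W`
(`IsNewformOf W f`: `aₙ(f) = aₙ(W)` for all `n`) whose cyclotomic `p`-adic `L`-function at the
unit root `α = unitRoot W p` of `X² - a_p X + p` is not the zero power series,
`padicLFunction f α ≠ 0` in `ℚ_p⟦T⟧` — the non-vanishing of the weight-`2` fibre of the
two-variable `p`-adic `L`-function used by the Strassmann step of the line.

This is EXACTLY the conjunction of two named facts of the tree: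

* modularity with level = conductor,
  `Literature.NumberTheory.EllipticCurves.ModularForms.exists_isNewformOf`
  (`Literature/NumberTheory/EllipticCurves/CuspFormLFunction.lean`; Wiles 1995, Taylor–Wiles 1995,
  Breuil–Conrad–Diamond–Taylor 2001, Thm. A; Carayol 1986; Diamond–Shurman 2005, Thm. 8.8.3) — a
  `def … : Prop` NOT discharged in the tree (only conditional derivations from BCDT Theorem B and
  Conrad–Diamond–Taylor §7 exist, e.g. `exists_isNewformOf_of_theoremB_of_CDT`), and
* Rohrlich's non-vanishing `Literature.NumberTheory.EllipticCurves.padicLFunction_ne_zero`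
  (`Literature/NumberTheory/EllipticCurves/PAdicLFunction.lean`; Rohrlich 1984, Theorem, p. 409,
  with Mazur–Tate–Teitelbaum 1986, §I.14), which IS discharged in the tree:
  `Literature.NumberTheory.EllipticCurves.padicLFunction_ne_zero_holds`
  (`PAdicLFunctionNeZeroHoldsProofs.lean`, axioms `propext`, `Classical.choice`, `Quot.sound`).

Hence the stub is equivalent to modularity for these `W` and cannot be landed under its registered
hypothesis-free name today. This file records the reduction, kernel-checked:
`stub_padicLFunctionNeZero_of_modularity` derives the registered statement of stub L from the
single hypothesis `(hmod : exists_isNewformOf)` — take `f` from `hmod W`, ordinarity from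
`isOrdinaryAt_iff`, and apply `padicLFunction_ne_zero_holds` — and
`stub_padicLFunctionNeZero_of_facts` is its registered colon form `exists_isNewformOf → (stub L
verbatim)`, registered as a sub-goal stub of the crux item. It is CONDITIONAL on that one named
fact, introduces no definition and no new named fact, and SUPPORTS stmt-BirchSwinnertonDyer-17609
(it does not close it, and it does not land stub L under its registered name). Nothing shaped like
the crux `EdgeCap` or like the neighbouring stubs M (`stub_membersExist`),
G (`stub_twoVariableInterpolation`), A2 (`stub_arcDivisibility`) is stated.

References: C. Breuil, B. Conrad, F. Diamond, R. Taylor, *On the modularity of elliptic curves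
over `ℚ`: wild 3-adic exercises*, J. Amer. Math. Soc. 14 (2001) 843–939, Thm. A
[BreuilConradDiamondTaylor2001]; F. Diamond, J. Shurman, *A first course in modular forms*,
GTM 228 (2005), Thm. 8.8.3 [DiamondShurman2005]; H. Carayol, Ann. Sci. ÉNS 19 (1986) 409–468
[Carayol1986]; A. Wiles, Ann. of Math. 141 (1995) 443–551 [Wiles1995]; D. E. Rohrlich, *On
`L`-functions of elliptic curves and cyclotomic towers*, Invent. Math. 75 (1984) 409–423, Theorem
(p. 409) [RohrlichInventiones1984]; B. Mazur, J. Tate, J. Teitelbaum, Invent. Math. 84 (1986)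
1–48, §I.14 [MazurTateTeitelbaum1986Invent].
-/

-- D-0017: single-problem summit, so `Summit.BirchSwinnertonDyer.BirchSwinnertonDyer.…` repeats a
-- namespace BY DESIGN.
set_option linter.dupNamespace false

noncomputable section

namespace Summit.BirchSwinnertonDyer.BirchSwinnertonDyer.Theorems

/-- **Stub L (`stub_padicLFunctionNeZero`) of line `ratio_measure_strassmann` (v7) for crux
`TangentCone.EdgeCap` (stmt-BirchSwinnertonDyer-17609), from the Modularity Theorem.** Assume
`Literature.NumberTheory.EllipticCurves.ModularForms.exists_isNewformOf` (every elliptic curve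
`E / ℚ` of conductor `N_E` has a newform `f ∈ S₂(Γ₀(N_E))` with `aₙ(f) = aₙ(E)`: Wiles 1995;
Taylor–Wiles 1995; Breuil–Conrad–Diamond–Taylor 2001, Thm. A; level `N_E` by Carayol 1986;
Diamond–Shurman 2005, Thm. 8.8.3). Then for every globally minimal Weierstrass equation `W` of an
elliptic curve over `ℚ` with `N = W.conductorNorm ℤ ≠ 0` and every prime `p ≥ 5` of good ordinary
reduction (`p ∤ a_p(E)`) there is a newform `f ∈ S₂(Γ₀(N))` attached to `W` with
`L_p(f, α, T) ≠ 0` in `ℚ_p⟦T⟧`, `α = unitRoot W p` the unit root of `X² - a_p X + p`.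
Proof: `f` from the hypothesis at `W`; `(W, p)` is ordinary by `isOrdinaryAt_iff`; the
non-vanishing is Rohrlich 1984, Theorem (p. 409), with Mazur–Tate–Teitelbaum 1986, §I.14 — the
tree theorem `Literature.NumberTheory.EllipticCurves.padicLFunction_ne_zero_holds` discharging the
named fact `padicLFunction_ne_zero`. The hypothesis `5 ≤ p` is not used.
[cite: BreuilConradDiamondTaylor2001, Thm. A] [cite: DiamondShurman2005, Thm. 8.8.3]
[cite: RohrlichInventiones1984, Theorem (p. 409)] -/
theorem stub_padicLFunctionNeZero_of_modularity
    (hmod : Literature.NumberTheory.EllipticCurves.ModularForms.exists_isNewformOf) :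
    ∀ (W : WeierstrassCurve ℚ) [W.IsElliptic] [W.IsGloballyMinimal] (_ : NeZero (W.conductorNorm ℤ)) (p : ℕ)
      [Fact p.Prime], 5 ≤ p → W.HasGoodReductionAtPrime p → ¬ (p : ℤ) ∣ W.frobeniusTrace p →
      ∃ f : CuspForm (CongruenceSubgroup.Gamma0 (W.conductorNorm ℤ)) 2,
        Literature.NumberTheory.EllipticCurves.ModularForms.IsNewformOf W f ∧
        Literature.NumberTheory.EllipticCurves.padicLFunction f
          (Literature.NumberTheory.EllipticCurves.unitRoot W p : ℚ_[p]) ≠ 0 := by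
  intro W _ _ hN p _ _ hgood hord
  -- the newform of `W` (modularity, level `N = W.conductorNorm ℤ`)
  obtain ⟨f, hf⟩ := hmod W
  -- `(W, p)` is good ordinary, so `L_p(f, unitRoot W p, T) ≠ 0` (Rohrlich, discharged in the tree)
  exact ⟨f, hf, Literature.NumberTheory.EllipticCurves.padicLFunction_ne_zero_holds
    ((Literature.NumberTheory.EllipticCurves.isOrdinaryAt_iff W p).mpr ⟨hgood, hord⟩) hf⟩

/-- **Registered form (`stub_padicLFunctionNeZero_of_facts`, colon form
`exists_isNewformOf → (stub L verbatim)`) of `stub_padicLFunctionNeZero_of_modularity`:** the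
Modularity Theorem (Breuil–Conrad–Diamond–Taylor 2001, Thm. A; Diamond–Shurman 2005, Thm. 8.8.3)
implies the statement of stub L of line `ratio_measure_strassmann` (crux `EdgeCap`,
stmt-BirchSwinnertonDyer-17609), Rohrlich's `L_p(E, T) ≠ 0` (Rohrlich 1984, Theorem, p. 409) being
the tree theorem `padicLFunction_ne_zero_holds`. [cite: BreuilConradDiamondTaylor2001, Thm. A]
[cite: RohrlichInventiones1984, Theorem (p. 409)] -/
theorem stub_padicLFunctionNeZero_of_facts :
    Literature.NumberTheory.EllipticCurves.ModularForms.exists_isNewformOf → (∀ (W : WeierstrassCurve ℚ) [W.IsElliptic] [W.IsGloballyMinimal] (_ : NeZero (W.conductorNorm ℤ)) (p : ℕ)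
      [Fact p.Prime], 5 ≤ p → W.HasGoodReductionAtPrime p → ¬ (p : ℤ) ∣ W.frobeniusTrace p →
      ∃ f : CuspForm (CongruenceSubgroup.Gamma0 (W.conductorNorm ℤ)) 2,
        Literature.NumberTheory.EllipticCurves.ModularForms.IsNewformOf W f ∧
        Literature.NumberTheory.EllipticCurves.padicLFunction f
          (Literature.NumberTheory.EllipticCurves.unitRoot W p : ℚ_[p]) ≠ 0) :=
  fun hmod => stub_padicLFunctionNeZero_of_modularity hmod

end Summit.BirchSwinnertonDyer.BirchSwinnertonDyer.Theorems

end
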